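import Summits.RiemannHypothesis.RiemannHypothesis.Theorems.SoloInformedGroundStateConvPow
import Summits.RiemannHypothesis.RiemannHypothesis.Theorems.SoloInformedGroundStateSeed

/-!
# Ground-state endgame, XIII: the λ-dependent family of seeds

Solo programme `solo-RiemannHypothesis-informed`, session 2 (claim C28). The seed of part VIII
has a fixed compactly supported bump, whose Fourier transform decays only like `e^{-o(ξ)}`; for the
doubly-exponential decay of the ground-state energy we smooth the bump by the rescaled
`(M+1)`-fold convolution power `ψ_M` of a fixed normed bump of radius `1/8` (part XI): the smoothed
bump `b_M = b ⋆ ψ_M ≥ 0` is supported in `[3/8, 9/8]`, has the same mass as `b`, and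
`𝓕 b_M = 𝓕 b · (𝓕φ(·/(M+1)))^{M+1}`. The seed `h_M(x) = b_M(2x) + b_M(-2x) − 2 b_M(4x) − 2 b_M(−4x)`
is even, Schwartz, supported in `[-9/16, 9/16]`, with `h_M(0) = 0 = ∫ h_M` and
`𝓜 h_M(2) = ⅛ ∫ y b_M(y) dy ≥ (3/64) ∫ b`, uniformly in `M`.
-/

noncomputable section

open Filter Set Topology MeasureTheory Convolution ContinuousLinearMap
open scoped FourierTransform ContDiff
open Literature.NumberTheory.LFunctions

namespace Summit.RiemannHypothesis.RiemannHypothesis.Theorems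

/-! ## The smoothing kernels `ψ_M` -/

/-- The bump at `0` with radii `1/16 < 1/8`. -/
def famKerBump : ContDiffBump (0 : ℝ) where
  rIn := 1 / 16
  rOut := 1 / 8
  rIn_pos := by norm_num
  rIn_lt_rOut := by norm_num

/-- The normalised kernel `φ = famKerBump.normed` (mass one, support `ball 0 (1/8)`). -/
def famKer : ℝ → ℝ := famKerBump.normed volume

/-- Continuity of `φ`. -/
theorem continuous_famKer : Continuous famKer := famKerBump.continuous_normed

/-- Compact support of `φ`. -/
theorem hasCompactSupport_famKer : HasCompactSupport famKer := famKerBump.hasCompactSupport_normed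

/-- `φ ≥ 0`. -/
theorem famKer_nonneg (x : ℝ) : 0 ≤ famKer x := famKerBump.nonneg_normed x

/-- `φ` is even. -/
theorem famKer_even (x : ℝ) : famKer (-x) = famKer x := famKerBump.normed_neg x

/-- `∫ φ = 1`. -/
theorem integral_famKer : ∫ x, famKer x = 1 := famKerBump.integral_normed

/-- `φ` vanishes off `[-1/8, 1/8]`. -/
theorem famKer_eq_zero_of_lt (x : ℝ) (hx : 1 / 8 < |x|) : famKer x = 0 := by
  have : x ∉ Function.support (famKerBump.normed volume) := by
    rw [famKerBump.support_normed_eq, Metric.mem_ball, dist_zero_right, Real.norm_eq_abs, not_lt]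
    exact hx.le
  exact Function.notMem_support.mp this

/-- The smoothing kernel `ψ_M = (M+1) φ^{⋆(M+1)}((M+1)·)`. -/
def famPsi (M : ℕ) : ℝ → ℝ := cpowScaled famKer M

/-- Continuity of `ψ_M`. -/
theorem continuous_famPsi (M : ℕ) : Continuous (famPsi M) :=
  continuous_cpowScaled continuous_famKer hasCompactSupport_famKer M

/-- `ψ_M` vanishes off `[-1/8, 1/8]`. -/
theorem famPsi_eq_zero_of_lt (M : ℕ) {x : ℝ} (hx : 1 / 8 < |x|) : famPsi M x = 0 :=
  cpowScaled_eq_zero_of_lt famKer_eq_zero_of_lt M hx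

/-- Compact support of `ψ_M`. -/
theorem hasCompactSupport_famPsi (M : ℕ) : HasCompactSupport (famPsi M) :=
  hasCompactSupport_cpowScaled famKer_eq_zero_of_lt M

/-- `ψ_M ≥ 0`. -/
theorem famPsi_nonneg (M : ℕ) (x : ℝ) : 0 ≤ famPsi M x := cpowScaled_nonneg famKer_nonneg M x

/-- `∫ ψ_M = 1`. -/
theorem integral_famPsi (M : ℕ) : ∫ x, famPsi M x = 1 := by
  unfold famPsi
  rw [integral_cpowScaled continuous_famKer hasCompactSupport_famKer, integral_famKer, one_pow]

/-- Integrability of `ψ_M`. -/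
theorem integrable_famPsi (M : ℕ) : Integrable (famPsi M) :=
  (continuous_famPsi M).integrable_of_hasCompactSupport (hasCompactSupport_famPsi M)

/-- `𝓕 ψ_M(ξ) = (𝓕 φ (ξ/(M+1)))^{M+1}`. -/
theorem fourier_famPsi (M : ℕ) (ξ : ℝ) :
    𝓕 (fun x => (famPsi M x : ℂ)) ξ = (𝓕 (fun x => (famKer x : ℂ)) (ξ / (M + 1))) ^ (M + 1) :=
  fourier_cpowScaled continuous_famKer hasCompactSupport_famKer M ξ

/-! ## The smoothed bumps `b_M = b ⋆ ψ_M` -/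

/-- The smoothed bump `b_M = seedBump ⋆ ψ_M`. -/
def bFam (M : ℕ) : ℝ → ℝ := (seedBump : ℝ → ℝ) ⋆[lsmul ℝ ℝ, volume] famPsi M

/-- Integrability of the bump. -/
theorem integrable_seedBump : Integrable (seedBump : ℝ → ℝ) :=
  seedBump.continuous.integrable_of_hasCompactSupport seedBump.hasCompactSupport

/-- Smoothness of `b_M`. -/
theorem contDiff_bFam (M : ℕ) : ContDiff ℝ ∞ (bFam M) :=
  seedBump.hasCompactSupport.contDiff_convolution_left _ seedBump.contDiff
    ((continuous_famPsi M).locallyIntegrable)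

/-- Continuity of `b_M`. -/
theorem continuous_bFam (M : ℕ) : Continuous (bFam M) := (contDiff_bFam M).continuous

/-- `b_M ≥ 0`. -/
theorem bFam_nonneg (M : ℕ) (x : ℝ) : 0 ≤ bFam M x := by
  rw [bFam, convolution_lsmul]
  exact integral_nonneg fun t => by
    simp only [Pi.zero_apply, smul_eq_mul]
    exact mul_nonneg (seedBump_nonneg t) (famPsi_nonneg M _)

/-- `b_M(x) = 0` for `x ≤ 3/8`. -/
theorem bFam_eq_zero_of_le (M : ℕ) {x : ℝ} (hx : x ≤ 3 / 8) : bFam M x = 0 := by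
  rw [bFam, convolution_lsmul]
  refine integral_eq_zero_of_ae (Eventually.of_forall fun t => ?_)
  simp only [Pi.zero_apply, smul_eq_mul]
  rcases le_or_gt t (1 / 2) with ht | ht
  · rw [seedBump_eq_zero (Or.inl ht), zero_mul]
  · rw [famPsi_eq_zero_of_lt M (by rw [abs_of_neg (by linarith)]; linarith), mul_zero]

/-- `b_M(x) = 0` for `x ≥ 9/8`. -/
theorem bFam_eq_zero_of_ge (M : ℕ) {x : ℝ} (hx : 9 / 8 ≤ x) : bFam M x = 0 := by
  rw [bFam, convolution_lsmul]
  refine integral_eq_zero_of_ae (Eventually.of_forall fun t => ?_)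
  simp only [Pi.zero_apply, smul_eq_mul]
  rcases lt_or_ge t 1 with ht | ht
  · rw [famPsi_eq_zero_of_lt M (by rw [abs_of_pos (by linarith)]; linarith), mul_zero]
  · rw [seedBump_eq_zero (Or.inr ht), zero_mul]

/-- `b_M(x) = 0` unless `3/8 < x < 9/8`. -/
theorem bFam_eq_zero (M : ℕ) {x : ℝ} (hx : x ≤ 3 / 8 ∨ 9 / 8 ≤ x) : bFam M x = 0 := by
  rcases hx with hx | hx
  exacts [bFam_eq_zero_of_le M hx, bFam_eq_zero_of_ge M hx]

/-- Compact support of `b_M`. -/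
theorem hasCompactSupport_bFam (M : ℕ) : HasCompactSupport (bFam M) :=
  HasCompactSupport.intro (K := Icc (3 / 8 : ℝ) (9 / 8)) isCompact_Icc fun x hx => by
    by_cases h : x ≤ 3 / 8
    · exact bFam_eq_zero_of_le M h
    · exact bFam_eq_zero_of_ge M (by
        by_contra h'
        exact hx ⟨le_of_lt (not_le.1 h), le_of_lt (not_le.1 h')⟩)

/-- Integrability of `b_M`. -/
theorem integrable_bFam (M : ℕ) : Integrable (bFam M) :=
  (continuous_bFam M).integrable_of_hasCompactSupport (hasCompactSupport_bFam M)

/-- Mass: `∫ b_M = ∫ b`. -/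
theorem integral_bFam (M : ℕ) : ∫ x, bFam M x = ∫ x, (seedBump : ℝ → ℝ) x := by
  rw [bFam, integral_convolution (lsmul ℝ ℝ) integrable_seedBump (integrable_famPsi M), integral_famPsi,
    lsmul_apply, smul_eq_mul, mul_one]

/-- `𝓕 b_M = 𝓕 b · (𝓕 φ(·/(M+1)))^{M+1}`. -/
theorem fourier_bFam (M : ℕ) (ξ : ℝ) :
    𝓕 (fun x => (bFam M x : ℂ)) ξ
      = 𝓕 (fun x => ((seedBump : ℝ → ℝ) x : ℂ)) ξ
        * (𝓕 (fun x => (famKer x : ℂ)) (ξ / (M + 1))) ^ (M + 1) := by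
  have heq : (fun x => (bFam M x : ℂ))
      = (fun t => ((seedBump : ℝ → ℝ) t : ℂ)) ⋆[mul ℂ ℂ, volume] (fun t => (famPsi M t : ℂ)) := by
    funext x
    exact ofReal_convolution_eq x
  have hf : Integrable (fun t => ((seedBump : ℝ → ℝ) t : ℂ)) := integrable_seedBump.ofReal
  have hg : Integrable (fun t => (famPsi M t : ℂ)) := (integrable_famPsi M).ofReal
  rw [heq, Real.fourier_mul_convolution_eq hf hg, fourier_famPsi]

/-! ## The real profiles `h_M` -/

/-- The real profile `b_M(2x) + b_M(-2x) − 2 b_M(4x) − 2 b_M(−4x)`. -/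
def famRe (M : ℕ) (x : ℝ) : ℝ :=
  bFam M (2 * x) + bFam M (-2 * x) - 2 * bFam M (4 * x) - 2 * bFam M (-4 * x)

/-- Smoothness of the profile. -/
theorem contDiff_famRe (M : ℕ) : ContDiff ℝ ∞ (famRe M) := by
  have hb : ContDiff ℝ ∞ (bFam M) := contDiff_bFam M
  have h : ∀ c : ℝ, ContDiff ℝ ∞ fun x : ℝ => bFam M (c * x) := fun c =>
    hb.comp (contDiff_const.mul contDiff_id)
  unfold famRe
  exact (((h 2).add (h (-2))).sub (contDiff_const.mul (h 4))).sub (contDiff_const.mul (h (-4)))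

/-- Continuity of the profile. -/
theorem continuous_famRe (M : ℕ) : Continuous (famRe M) := (contDiff_famRe M).continuous

/-- The profile is even. -/
theorem famRe_even (M : ℕ) (x : ℝ) : famRe M (-x) = famRe M x := by
  unfold famRe
  rw [show (2 : ℝ) * -x = -2 * x by ring, show (-2 : ℝ) * -x = 2 * x by ring,
    show (4 : ℝ) * -x = -4 * x by ring, show (-4 : ℝ) * -x = 4 * x by ring]
  ring

/-- `famRe M 0 = 0`. -/
theorem famRe_zero (M : ℕ) : famRe M 0 = 0 := by
  unfold famRe
  rw [mul_zero, mul_zero, mul_zero, mul_zero, bFam_eq_zero_of_le M (by norm_num)]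
  ring

/-- The profile vanishes for `|x| ≥ 9/16`. -/
theorem famRe_eq_zero_of_le (M : ℕ) {x : ℝ} (hx : 9 / 16 ≤ |x|) : famRe M x = 0 := by
  unfold famRe
  rcases le_or_gt 0 x with h | h
  · rw [abs_of_nonneg h] at hx
    rw [bFam_eq_zero M (Or.inr (by linarith)), bFam_eq_zero M (Or.inl (by linarith)),
      bFam_eq_zero M (Or.inr (by linarith)), bFam_eq_zero M (Or.inl (by linarith))]
    ring
  · rw [abs_of_neg h] at hx
    rw [bFam_eq_zero M (Or.inl (by linarith)), bFam_eq_zero M (Or.inr (by linarith)),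
      bFam_eq_zero M (Or.inl (by linarith)), bFam_eq_zero M (Or.inr (by linarith))]
    ring

/-- On `0 ≤ x`: `famRe M x = b_M(2x) − 2 b_M(4x)`. -/
theorem famRe_of_nonneg (M : ℕ) {x : ℝ} (hx : 0 ≤ x) :
    famRe M x = bFam M (2 * x) - 2 * bFam M (4 * x) := by
  unfold famRe
  rw [bFam_eq_zero M (x := -2 * x) (Or.inl (by linarith)),
    bFam_eq_zero M (x := -4 * x) (Or.inl (by linarith))]
  ring

/-- Compact support of the profile. -/
theorem hasCompactSupport_famRe (M : ℕ) : HasCompactSupport (famRe M) :=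
  HasCompactSupport.intro (K := Icc (-1 : ℝ) 1) isCompact_Icc fun x hx =>
    famRe_eq_zero_of_le M (by
      rcases le_or_gt 0 x with h | h
      · rw [abs_of_nonneg h]
        by_contra h'
        exact hx ⟨by linarith, by linarith [not_le.1 h']⟩
      · rw [abs_of_neg h]
        by_contra h'
        exact hx ⟨by linarith [not_le.1 h'], by linarith⟩)

/-- Dilates of `b_M` integrate to `|c|⁻¹ ∫ b`. -/
theorem integral_bFam_comp_mul (M : ℕ) (c : ℝ) :
    ∫ x : ℝ, bFam M (c * x) = |c⁻¹| * ∫ x, (seedBump : ℝ → ℝ) x := by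
  rw [Measure.integral_comp_mul_left (fun y : ℝ => bFam M y) c, smul_eq_mul, integral_bFam]

/-- Integrability of the dilates. -/
theorem integrable_bFam_comp_mul (M : ℕ) {c : ℝ} (hc : c ≠ 0) :
    Integrable (fun x : ℝ => bFam M (c * x)) := (integrable_bFam M).comp_mul_left' hc

/-- **Vanishing integral**: `∫ famRe M = 0`. -/
theorem integral_famRe (M : ℕ) : ∫ x : ℝ, famRe M x = 0 := by
  have i1 := integrable_bFam_comp_mul M (c := 2) (by norm_num)
  have i2 := integrable_bFam_comp_mul M (c := -2) (by norm_num)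
  have i3 := (integrable_bFam_comp_mul M (c := 4) (by norm_num)).const_mul 2
  have i4 := (integrable_bFam_comp_mul M (c := -4) (by norm_num)).const_mul 2
  have step : ∫ x : ℝ, famRe M x
      = (∫ x : ℝ, bFam M (2 * x)) + (∫ x : ℝ, bFam M (-2 * x))
        - 2 * (∫ x : ℝ, bFam M (4 * x)) - 2 * ∫ x : ℝ, bFam M (-4 * x) := by
    have i12 : Integrable (fun x : ℝ => bFam M (2 * x) + bFam M (-2 * x)) volume := i1.add i2
    have i123 : Integrable (fun x : ℝ => bFam M (2 * x) + bFam M (-2 * x)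
        - 2 * bFam M (4 * x)) volume := i12.sub i3
    unfold famRe
    rw [integral_sub i123 i4, integral_sub i12 i3, integral_add i1 i2,
      integral_const_mul, integral_const_mul]
  rw [step, integral_bFam_comp_mul, integral_bFam_comp_mul, integral_bFam_comp_mul,
    integral_bFam_comp_mul]
  norm_num
  ring

/-- **First moment from below**: `(3/8) ∫ b ≤ ∫ x b_M(x) dx` (as `b_M ≥ 0` lives on `x ≥ 3/8`). -/
theorem integral_mul_bFam_ge (M : ℕ) :
    3 / 8 * ∫ x, (seedBump : ℝ → ℝ) x ≤ ∫ x : ℝ, x * bFam M x := by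
  rw [← integral_bFam M, ← integral_const_mul]
  refine integral_mono ((integrable_bFam M).const_mul _)
    ((continuous_id.mul (continuous_bFam M)).integrable_of_hasCompactSupport
      (hasCompactSupport_bFam M).mul_left) fun x => ?_
  simp only
  rcases le_or_gt x (3 / 8) with h | h
  · rw [bFam_eq_zero_of_le M h, mul_zero, mul_zero]
  · exact mul_le_mul_of_nonneg_right h.le (bFam_nonneg M x)

/-- `0 < ∫ b`. -/
theorem integral_seedBump_pos : 0 < ∫ x, (seedBump : ℝ → ℝ) x := seedBump.integral_pos

/-! ## The complex seeds `h_M` as Schwartz functions -/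

/-- Compact support of the complexified profile. -/
theorem hasCompactSupport_famC (M : ℕ) : HasCompactSupport fun x : ℝ => (famRe M x : ℂ) :=
  (hasCompactSupport_famRe M).comp_left Complex.ofReal_zero

/-- Smoothness of the complexified profile. -/
theorem contDiff_famC (M : ℕ) : ContDiff ℝ ∞ fun x : ℝ => (famRe M x : ℂ) :=
  Complex.ofRealCLM.contDiff.comp (contDiff_famRe M)

/-- **The seed family** `hFam M : 𝓢(ℝ, ℂ)`. -/
def hFam (M : ℕ) : SchwartzMap ℝ ℂ := (hasCompactSupport_famC M).toSchwartzMap (contDiff_famC M)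

/-- Pointwise formula. -/
@[simp] theorem hFam_apply (M : ℕ) (x : ℝ) : hFam M x = (famRe M x : ℂ) := rfl

/-- The seeds are even. -/
theorem hFam_even (M : ℕ) (x : ℝ) : hFam M (-x) = hFam M x := by
  rw [hFam_apply, hFam_apply, famRe_even]

/-- `hFam M 0 = 0`. -/
theorem hFam_zero (M : ℕ) : hFam M 0 = 0 := by
  rw [hFam_apply, famRe_zero, Complex.ofReal_zero]

/-- `∫ hFam M = 0`. -/
theorem integral_hFam (M : ℕ) : ∫ x : ℝ, hFam M x = 0 := by
  simp only [hFam_apply]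
  rw [integral_complex_ofReal, integral_famRe, Complex.ofReal_zero]

/-- The seeds vanish beyond `1`. -/
theorem hFam_eq_zero_of_one_lt (M : ℕ) (x : ℝ) (hx : 1 < x) : hFam M x = 0 := by
  rw [hFam_apply, famRe_eq_zero_of_le M (by rw [abs_of_pos (by linarith)]; linarith),
    Complex.ofReal_zero]

/-- **The Mellin transform at `2`**: `𝓜 h_M (2) = ⅛ ∫ x b_M(x) dx`. -/
theorem mellin_hFam_two (M : ℕ) :
    mellin (fun x : ℝ => hFam M x) 2 = (((∫ x : ℝ, x * bFam M x) / 8 : ℝ) : ℂ) := by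
  set m : ℝ := ∫ x : ℝ, x * bFam M x with hm
  set φ : ℝ → ℝ := fun x => x * bFam M (2 * x) - 2 * (x * bFam M (4 * x)) with hφ
  have hφ0 : ∀ x : ℝ, x ≤ 0 → φ x = 0 := fun x hx => by
    simp only [hφ]
    rw [bFam_eq_zero M (Or.inl (by linarith)), bFam_eq_zero M (Or.inl (by linarith))]
    ring
  have h1 : mellin (fun x : ℝ => hFam M x) 2 = ∫ x : ℝ in Ioi 0, ((φ x : ℝ) : ℂ) := by
    unfold mellin
    refine setIntegral_congr_fun measurableSet_Ioi fun x (hx : 0 < x) => ?_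
    simp only [hφ, hFam_apply, famRe_of_nonneg M hx.le, smul_eq_mul]
    rw [show (2 : ℂ) - 1 = 1 by norm_num, Complex.cpow_one]
    push_cast
    ring
  have h2 : ∫ x : ℝ in Ioi 0, ((φ x : ℝ) : ℂ) = ∫ x : ℝ, ((φ x : ℝ) : ℂ) := by
    refine setIntegral_eq_integral_of_forall_compl_eq_zero fun x hx => ?_
    rw [hφ0 x (not_lt.1 hx), Complex.ofReal_zero]
  rw [h1, h2, integral_complex_ofReal]
  congr 1
  have i1 : Integrable (fun x : ℝ => x * bFam M x) volume :=
    (continuous_id.mul (continuous_bFam M)).integrable_of_hasCompactSupport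
      (hasCompactSupport_bFam M).mul_left
  have hdil : ∀ c : ℝ, 0 < c → Integrable (fun x : ℝ => x * bFam M (c * x)) volume ∧
      ∫ x : ℝ, x * bFam M (c * x) = m / c ^ 2 := by
    intro c hc
    have key := Measure.integral_comp_mul_left (fun y : ℝ => y * bFam M y) c
    rw [smul_eq_mul, abs_of_pos (inv_pos.2 hc), ← hm] at key
    have heq : (fun x : ℝ => x * bFam M (c * x)) = fun x => c⁻¹ * (c * x * bFam M (c * x)) := by
      funext x; field_simp
    refine ⟨?_, ?_⟩
    · rw [heq]
      exact ((i1.comp_mul_left' hc.ne')).const_mul _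
    · rw [heq, integral_const_mul, key]
      field_simp
  obtain ⟨i2, e2⟩ := hdil 2 two_pos
  obtain ⟨i4, e4⟩ := hdil 4 (by norm_num)
  simp only [hφ]
  rw [integral_sub i2 (i4.const_mul 2), integral_const_mul, e2, e4]
  ring

/-- **Uniform lower bound** `‖𝓜 h_M (2)‖ ≥ (3/64) ∫ b > 0`. -/
theorem norm_mellin_hFam_two_ge (M : ℕ) :
    3 / 64 * ∫ x, (seedBump : ℝ → ℝ) x ≤ ‖mellin (fun x : ℝ => hFam M x) 2‖ := by
  rw [mellin_hFam_two, Complex.norm_real, Real.norm_eq_abs]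
  have := integral_mul_bFam_ge M
  have h0 := integral_seedBump_pos
  rw [abs_of_nonneg (by linarith)]
  linarith

end Summit.RiemannHypothesis.RiemannHypothesis.Theorems
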